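import Mathlib
import HarnessLib

/-!
# Route `IntegerScrew` — the mixture lemma: a tilted density is a superposition of windows
# (CONTINUUM-LIMIT §25.10 (c) in the kernel; pure finite Abel summation + Cauchy–Schwarz)

THEOREM B's exit measure on the bottom `B` of a true cell differs from the flat (harmonic) one by a TILT:
a density `τ(b)` of bounded variation in `b` (CONTINUUM-LIMIT 25.10 (b)).  The mixture lemma 25.10 (c) says
that pairing a zero-mass tilted measure with a test function `g` is a superposition, over the thresholds
`θ`, of WINDOW functionals of `B` itself — so its transport cost is controlled by the window law on `B`
(THEOREM A there) weighted by the total variation of `τ`.  Here this is proved as exact finite algebra, for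
arbitrary non-negative weights `w` on `{1,…,Q}` (harmonic weights `w b = 1/b` on an interval, or
`w b = 𝟙[b p-free]/b` on an atom):

* `(∑ b ∈ Icc 1 θ, w b) = Σ_{b≤θ} w b`, `(∑ b ∈ Icc 1 θ, w b * g b) = Σ_{b≤θ} w b·g b`;
* `tilt_abel` — Abel summation: `Σ_{b≤Q} τ(b) w(b) g(b) = τ(Q)·G(Q) − Σ_{1≤θ<Q} (τ(θ+1) − τ(θ))·G(θ)`;
* **`tilt_centred_eq_sum_windows`** — with `τ̄ = (Σ_b τ w)/H(Q)` (so that the tilt has mass zero):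
  `Σ_b τ(b)w(b)g(b) − τ̄·G(Q) = Σ_{1≤θ<Q} (τ(θ+1) − τ(θ))·[H(θ)·G(Q)/H(Q) − G(θ)]`, and
  `H(θ)·G(Q)/H(Q) − G(θ) = (H(θ)/H(Q))·WF(θ)`, `WF(θ) = Σ_{θ<b≤Q} w g − (H_W/H(θ))·Σ_{b≤θ} w g` the window
  functional of the window `(θ, Q]` of `B` (`bracket_eq_windowFunctional`);
* **`tilt_centred_sq_le`** — Cauchy–Schwarz over the thresholds:
  `(Σ_b τ w g − τ̄ G(Q))² ≤ TV(τ)·Σ_{1≤θ<Q} |τ(θ+1) − τ(θ)|·[H(θ)G(Q)/H(Q) − G(θ)]²`, `TV(τ) = Σ_θ |τ(θ+1) − τ(θ)|`.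

Plugging THEOREM A's window law (`IntegerScrewExitAssembly.window_functional_sq_le` on `Ω_Q`) into each
bracket gives 25.10 (d).  RH-free; nothing in this file bears on the truth of RH.
References: CONTINUUM-LIMIT §25.10 (rh-explicit A6-PIVOT); M. Suzuki, J. Lond. Math. Soc. (2) 108 (2023)
1448–1487 [Suzuki2023].
-/

noncomputable section

set_option linter.dupNamespace false -- D-0017: `Summit.<S>.<S>.…` is the designed namespace

namespace Summit.RiemannHypothesis.RiemannHypothesis.Theorems.IntegerScrew

open Finset

/-! ### Notation

Throughout, `H(θ) := Σ_{b ∈ [1,θ]} w b` (bottom mass) and `G(θ) := Σ_{b ∈ [1,θ]} w b·g b` (bottom pairing) are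
written out as `Finset` sums (no definitions: this file is pure algebra). -/

/-! ### Abel summation -/

/-- **Abel summation for the tilt**: `Σ_{b≤Q} τ(b) w(b) g(b) = τ(Q)·G(Q) − Σ_{1≤θ<Q} (τ(θ+1) − τ(θ))·G(θ)`. -/
theorem tilt_abel (w g τ : ℕ → ℝ) (Q : ℕ) :
    ∑ b ∈ Icc 1 Q, τ b * w b * g b =
      τ Q * (∑ b ∈ Icc 1 Q, w b * g b) - ∑ θ ∈ Ico 1 Q, (τ (θ + 1) - τ θ) * (∑ b ∈ Icc 1 θ, w b * g b) := by
  induction Q with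
  | zero => simp
  | succ Q ih =>
    rw [Finset.sum_Icc_succ_top (by omega), ih, Finset.sum_Icc_succ_top (show 1 ≤ Q + 1 by omega)]
    rcases Nat.eq_zero_or_pos Q with hQ | hQ
    · subst hQ
      simp
      ring
    · rw [Finset.sum_Ico_succ_top hQ]
      ring

/-! ### The centred tilt as a superposition of windows -/

/-- **The mixture identity (CONTINUUM-LIMIT 25.10 (c)).**  With `τ̄ = (Σ_{b≤Q} τ w)/H(Q)` and `H(Q) ≠ 0`:
`Σ_{b≤Q} τ(b)w(b)g(b) − τ̄·G(Q) = Σ_{1≤θ<Q} (τ(θ+1) − τ(θ))·(H(θ)·G(Q)/H(Q) − G(θ))`. -/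
theorem tilt_centred_eq_sum_windows (w g τ : ℕ → ℝ) {Q : ℕ} (hH : (∑ b ∈ Icc 1 Q, w b) ≠ 0) :
    ∑ b ∈ Icc 1 Q, τ b * w b * g b - (∑ b ∈ Icc 1 Q, τ b * w b) / (∑ b ∈ Icc 1 Q, w b) * (∑ b ∈ Icc 1 Q, w b * g b) =
      ∑ θ ∈ Ico 1 Q, (τ (θ + 1) - τ θ) * ((∑ b ∈ Icc 1 θ, w b) * (∑ b ∈ Icc 1 Q, w b * g b) / (∑ b ∈ Icc 1 Q, w b) - (∑ b ∈ Icc 1 θ, w b * g b)) := by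
  have h1 := tilt_abel w g τ Q
  have h2 : ∑ b ∈ Icc 1 Q, τ b * w b =
      τ Q * (∑ b ∈ Icc 1 Q, w b) - ∑ θ ∈ Ico 1 Q, (τ (θ + 1) - τ θ) * (∑ b ∈ Icc 1 θ, w b) := by
    have := tilt_abel w (fun _ => 1) τ Q
    simp only [mul_one] at this
    exact this
  rw [h1, h2]
  have hexp : ∑ θ ∈ Ico 1 Q, (τ (θ + 1) - τ θ) *
      ((∑ b ∈ Icc 1 θ, w b) * (∑ b ∈ Icc 1 Q, w b * g b) / (∑ b ∈ Icc 1 Q, w b) - (∑ b ∈ Icc 1 θ, w b * g b)) =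
      (∑ θ ∈ Ico 1 Q, (τ (θ + 1) - τ θ) * (∑ b ∈ Icc 1 θ, w b)) * ((∑ b ∈ Icc 1 Q, w b * g b) / (∑ b ∈ Icc 1 Q, w b)) -
        ∑ θ ∈ Ico 1 Q, (τ (θ + 1) - τ θ) * (∑ b ∈ Icc 1 θ, w b * g b) := by
    rw [Finset.sum_mul, ← Finset.sum_sub_distrib]
    exact Finset.sum_congr rfl fun θ _ => by ring
  rw [hexp]
  field_simp
  ring

/-- The bracket is the window functional of the window `(θ, Q]` of `B`, scaled by `H(θ)/H(Q)`:
`H(θ)·G(Q)/H(Q) − G(θ) = (H(θ)/H(Q))·[Σ_{θ<b≤Q} w g − ((H(Q) − H(θ))/H(θ))·Σ_{b≤θ} w g]` (`H(θ), H(Q) ≠ 0`,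
`θ ≤ Q`). -/
theorem bracket_eq_windowFunctional (w g : ℕ → ℝ) {θ Q : ℕ} (hθQ : θ ≤ Q) (hθ : (∑ b ∈ Icc 1 θ, w b) ≠ 0)
    (hQ : (∑ b ∈ Icc 1 Q, w b) ≠ 0) :
    (∑ b ∈ Icc 1 θ, w b) * (∑ b ∈ Icc 1 Q, w b * g b) / (∑ b ∈ Icc 1 Q, w b) - (∑ b ∈ Icc 1 θ, w b * g b) =
      (∑ b ∈ Icc 1 θ, w b) / (∑ b ∈ Icc 1 Q, w b) *
        (∑ b ∈ Ioc θ Q, w b * g b -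
          ((∑ b ∈ Icc 1 Q, w b) - (∑ b ∈ Icc 1 θ, w b)) / (∑ b ∈ Icc 1 θ, w b) * ∑ b ∈ Icc 1 θ, w b * g b) := by
  have hsplit : (∑ b ∈ Icc 1 Q, w b * g b) = (∑ b ∈ Icc 1 θ, w b * g b) + ∑ b ∈ Ioc θ Q, w b * g b := by
    have hU : Icc 1 Q = Icc 1 θ ∪ Ioc θ Q := by
      ext b; simp only [Finset.mem_union, Finset.mem_Icc, Finset.mem_Ioc]; omega
    rw [hU, Finset.sum_union]
    rw [Finset.disjoint_left]; intro b hb hb'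
    have := Finset.mem_Icc.1 hb; have := Finset.mem_Ioc.1 hb'; omega
  rw [hsplit]
  field_simp
  ring

/-! ### Cauchy–Schwarz over the thresholds -/

/-- **The mixture lemma, quadratic form (CONTINUUM-LIMIT 25.10 (c)).**  With
`TV(τ) = Σ_{1≤θ<Q} |τ(θ+1) − τ(θ)|` and `H(Q) ≠ 0`:
`(Σ_b τ w g − τ̄·G(Q))² ≤ TV(τ) · Σ_{1≤θ<Q} |τ(θ+1) − τ(θ)|·(H(θ)G(Q)/H(Q) − G(θ))²`. -/
theorem tilt_centred_sq_le (w g τ : ℕ → ℝ) {Q : ℕ} (hH : (∑ b ∈ Icc 1 Q, w b) ≠ 0) :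
    (∑ b ∈ Icc 1 Q, τ b * w b * g b - (∑ b ∈ Icc 1 Q, τ b * w b) / (∑ b ∈ Icc 1 Q, w b) * (∑ b ∈ Icc 1 Q, w b * g b)) ^ 2 ≤
      (∑ θ ∈ Ico 1 Q, |τ (θ + 1) - τ θ|) *
        ∑ θ ∈ Ico 1 Q, |τ (θ + 1) - τ θ| *
          ((∑ b ∈ Icc 1 θ, w b) * (∑ b ∈ Icc 1 Q, w b * g b) / (∑ b ∈ Icc 1 Q, w b) - (∑ b ∈ Icc 1 θ, w b * g b)) ^ 2 := by
  rw [tilt_centred_eq_sum_windows w g τ hH]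
  -- (Σ Δ·X)² ≤ (Σ |Δ|)(Σ |Δ| X²)
  refine Finset.sum_sq_le_sum_mul_sum_of_sq_le_mul (Ico 1 Q) (fun θ _ => abs_nonneg _)
    (fun θ _ => mul_nonneg (abs_nonneg _) (sq_nonneg _)) (fun θ _ => ?_)
  rw [mul_pow, ← sq_abs (τ (θ + 1) - τ θ)]
  ring_nf
  exact le_rfl

/-- **The mixture lemma with a per-threshold window bound.**  If every bracket obeys
`(H(θ)G(Q)/H(Q) − G(θ))² ≤ K θ` (`1 ≤ θ < Q`; e.g. THEOREM A's window law on `B` times `(H(θ)/H(Q))²`), then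
`(Σ_b τ w g − τ̄·G(Q))² ≤ TV(τ)·Σ_{1≤θ<Q} |τ(θ+1) − τ(θ)|·K θ`. -/
theorem tilt_centred_sq_le_of_window_bound (w g τ : ℕ → ℝ) {Q : ℕ} (hH : (∑ b ∈ Icc 1 Q, w b) ≠ 0) (K : ℕ → ℝ)
    (hK : ∀ θ ∈ Ico 1 Q, ((∑ b ∈ Icc 1 θ, w b) * (∑ b ∈ Icc 1 Q, w b * g b) / (∑ b ∈ Icc 1 Q, w b) - (∑ b ∈ Icc 1 θ, w b * g b)) ^ 2 ≤ K θ) :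
    (∑ b ∈ Icc 1 Q, τ b * w b * g b - (∑ b ∈ Icc 1 Q, τ b * w b) / (∑ b ∈ Icc 1 Q, w b) * (∑ b ∈ Icc 1 Q, w b * g b)) ^ 2 ≤
      (∑ θ ∈ Ico 1 Q, |τ (θ + 1) - τ θ|) * ∑ θ ∈ Ico 1 Q, |τ (θ + 1) - τ θ| * K θ := by
  refine (tilt_centred_sq_le w g τ hH).trans (mul_le_mul_of_nonneg_left ?_
    (Finset.sum_nonneg fun θ _ => abs_nonneg _))
  exact Finset.sum_le_sum fun θ hθ => mul_le_mul_of_nonneg_left (hK θ hθ) (abs_nonneg _)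

/-- **With a uniform window bound**: if every bracket window is `≤ K₀`, the tilted centred functional is
`≤ TV(τ)²·K₀`. -/
theorem tilt_centred_sq_le_of_window_bound_const (w g τ : ℕ → ℝ) {Q : ℕ} (hH : (∑ b ∈ Icc 1 Q, w b) ≠ 0) {K₀ : ℝ}
    (hK : ∀ θ ∈ Ico 1 Q, ((∑ b ∈ Icc 1 θ, w b) * (∑ b ∈ Icc 1 Q, w b * g b) / (∑ b ∈ Icc 1 Q, w b) - (∑ b ∈ Icc 1 θ, w b * g b)) ^ 2 ≤ K₀) :
    (∑ b ∈ Icc 1 Q, τ b * w b * g b - (∑ b ∈ Icc 1 Q, τ b * w b) / (∑ b ∈ Icc 1 Q, w b) * (∑ b ∈ Icc 1 Q, w b * g b)) ^ 2 ≤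
      (∑ θ ∈ Ico 1 Q, |τ (θ + 1) - τ θ|) ^ 2 * K₀ := by
  refine (tilt_centred_sq_le_of_window_bound w g τ hH (fun _ => K₀) hK).trans (le_of_eq ?_)
  rw [← Finset.sum_mul, sq, mul_assoc]

end Summit.RiemannHypothesis.RiemannHypothesis.Theorems.IntegerScrew

end
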